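import Literature.Computability.Complexity.SuccinctCircuitBitsSigned
import Literature.Computability.Complexity.SuccinctCircuitBitsEvaluator
import Literature.Computability.Complexity.PSpaceClosure
import Literature.Computability.Complexity.SpaceTMSATHard
import HarnessLib

/-!
# Succinct arithmetic circuits of polynomial depth, VII: the sign–magnitude read-out of an integer
# circuit is a `PSPACE` language

Sequel of parts III (`bitLang_mem_PSPACE`) and IV (two's-complement read-out lemmas
`neg_iff_testBit`, `testBit_natAbs_of_nonneg`). The last generic step for an INTEGER consumer (the
KV20 M1 linear algebra, whose target `coeffBitLanguage` asks, of an integer coefficient, "is it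
negative?" and "is bit `j` of its absolute value set?" — Koiran–Perifel's coefficient function,
§3.1 Def. 1):

* `setOf_codeFP_mem_PSPACE` — a polynomial-time Boolean test on strings defines a language in
  `PSPACE`; `setOf_testBit_val_mem_PSPACE` — "bit `ix w` of the value of gate `gt w`" is a `PSPACE` predicate
  of `w` for polynomial-time `gt`, `ix` (a preimage of `bitLang`).
* **`SuccCircuit.signMag_mem_PSPACE_of_rep`** — for a succinct circuit whose polynomial-time
  decoded gates `pos w`, `neg w` hold two's-complement REPRESENTATIVES (modulo `2^{v_w+1}`) of an
  integer `x_w` and of `−x_w`, with `|x_w| < 2^{v_w}`, and polynomial-time `idx w`, `knd w`, `v_w`: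
  the language `{w | (knd w = 1 ∧ x_w < 0) ∨ (knd w = 0 ∧ bit (idx w) of |x_w| = 1)}` is in `PSPACE`
  — sign = bit `v_w` of the representative of `x_w`, magnitude bits = bits of the representative of
  `x_w` or of `−x_w` (`bitLang` queries), combined by the Boolean closure of `PSPACE`
  (`PSpaceClosure.lean`, with the `PSPACE`-complete language of `SpaceTMSATHard.lean`). This covers
  the `(x⁺, x⁻)` pair encoding (`x⁺ + (2^{v+1} − 1)·x⁻ ≡ x⁺ − x⁻`, part IV `add_rep`/`neg_rep`) and
  the integer circuits of part V (`SuccCircuitZ.signMag_mem_PSPACE` there).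

So the consumer supplies: the circuit, the five decoders, the height bound and the two congruences
— and no machine, no quantifier plumbing.

HONEST FRAMING (val-lit, KV20 M1 programme, brick (P2) layer G): generic plumbing; proves nothing
about `kumarVolk2020_cor_1_3` by itself; `VP ≠ VNP` is NOT proved and nothing here bears on it.

## References

* P. Koiran, S. Perifel, *VPSPACE and a transfer theorem over the reals*, Comput. Complexity 18
  (2009), §3.1, Def. 1 ("a(n, α, i) is the i-th bit … a(n, α, 0) is the sign") and §3.2, Prop. 1
  [KoiranPerifel2009VPSPACE].
* D. E. Knuth, *TAOCP 2*, §4.1 (two's complement) [KnuthTAOCP2].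
* S. Arora, B. Barak, *Computational Complexity*, Def. 1.13, Thm. 4.2 / §4.1 [AroraBarak2009].
-/

noncomputable section

namespace Literature.Computability.Complexity

open _root_.Computability Polynomial CodeFP Brick Finset

/-! ### Atoms -/

/-- A polynomial-time Boolean test on strings defines a language in `P` (a private twin of
`GSTRefuter.memP_of_codeFP` of `MetaComplexity/ConstructiveSeparationsProofs.lean`, kept local so
that this file does not import that development). [cite: AroraBarak2009, Def. 1.13] -/
private theorem setOf_codeFP_mem_P {p : List Bool → Bool} (hp : CodeFP strE bitE p) : ({w | p w = true} : Language Bool) ∈ Classes.P := by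
  obtain ⟨f, hf, hfp⟩ := hp
  refine mem_P_of_mem_FP hf _ fun w => ⟨fun hw => ?_, fun hw => ?_⟩
  · have h : f w = [p w] := hfp w
    rw [h, show p w = true from hw]
  · have h : f w = [p w] := hfp w
    have : p w ≠ true := hw
    rw [h, Bool.eq_false_iff.2 this]

/-- A polynomial-time Boolean test on strings defines a language in `PSPACE`. [cite: AroraBarak2009, Thm. 4.2 and §4.1 (P ⊆ PSPACE)] -/
theorem setOf_codeFP_mem_PSPACE {p : List Bool → Bool} (hp : CodeFP strE bitE p) :
    ({w | p w = true} : Language Bool) ∈ PSPACE :=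
  P_subset_PSPACE_holds (setOf_codeFP_mem_P hp)

namespace SuccCircuit

/-- **Bit queries through polynomial-time name and index maps are `PSPACE` predicates**: for a
succinct circuit `K` and polynomial-time `gt`, `ix`, the set of `w` with bit `ix w` of `val (gt w)` set
is in `PSPACE` (a preimage of `bitLang`). [cite: KoiranPerifel2009VPSPACE, §3.2, Prop. 1] -/
theorem setOf_testBit_val_mem_PSPACE (K : SuccCircuit) {gt : List Bool → List Bool} {ix : List Bool → ℕ}
    (hg : CodeFP strE strE gt) (hi : CodeFP strE natE ix) :
    ({w | (K.val (gt w)).testBit (ix w) = true} : Language Bool) ∈ PSPACE := by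
  obtain ⟨f, hf, hfe⟩ := (hg.pair hi : CodeFP strE (pairE strE natE) fun w => (gt w, ix w))
  have hpre := preimage_mem_PSPACE K.bitLang_mem_PSPACE hf
  have hset : ({w | (K.val (gt w)).testBit (ix w) = true} : Language Bool) = f ⁻¹' K.bitLang := by
    ext w
    change (K.val (gt w)).testBit (ix w) = true ↔ f w ∈ K.bitLang
    have hw : f w = boolPair (gt w) (natE (ix w)) := hfe w
    rw [hw]
    exact (K.mem_bitLang_iff (gt w) (ix w)).symm
  rw [hset]
  exact hpre

/-- **Sign–magnitude read-out from two's-complement representatives.** Let `K` be a succinct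
circuit and, for every string `w` (a query), let polynomial-time decoders give a gate `pos w`
holding a representative of an integer `x_w` modulo `2^{v_w + 1}`, a gate `neg w` holding a
representative of `−x_w`, a bit index `idx w`, a query kind `knd w` and the bound exponent `v_w`
with `|x_w| < 2^{v_w}`. Then `{w | (knd w = 1 ∧ x_w < 0) ∨ (knd w = 0 ∧ bit (idx w) of |x_w| = 1)}`
is in `PSPACE`: the sign is bit `v_w` of `val (pos w)`, the magnitude bits are those of
`val (pos w)` (`x_w ≥ 0`) or of `val (neg w)` (`x_w < 0`) — `bitLang` queries — combined by the
Boolean closure of `PSPACE`. (This serves the `(x⁺, x⁻)` encoding as well: `x⁺ + (2^{v+1} − 1)·x⁻`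
represents `x⁺ − x⁻`, `add_rep`/`neg_rep`.) [cite: KoiranPerifel2009VPSPACE, §3.1, Def. 1 and §3.2, Prop. 1] [cite: KnuthTAOCP2, §4.1] -/
theorem signMag_mem_PSPACE_of_rep (K : SuccCircuit)
    {pos neg : List Bool → List Bool} {idx knd v : List Bool → ℕ} {x : List Bool → ℤ}
    (hpos : CodeFP strE strE pos) (hneg : CodeFP strE strE neg) (hidx : CodeFP strE natE idx)
    (hknd : CodeFP strE natE knd) (hv : CodeFP strE natE v)
    (hxb : ∀ w, (x w).natAbs < 2 ^ v w)
    (hp : ∀ w, ((K.val (pos w) : ℕ) : ℤ) ≡ x w [ZMOD 2 ^ (v w + 1)])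
    (hn : ∀ w, ((K.val (neg w) : ℕ) : ℤ) ≡ -x w [ZMOD 2 ^ (v w + 1)]) :
    ({w | (knd w = 1 ∧ x w < 0) ∨ (knd w = 0 ∧ (x w).natAbs.testBit (idx w) = true)} : Language Bool) ∈ PSPACE := by
  obtain ⟨B, hB⟩ := exists_isComplete_PSPACE_holds
  -- the atoms
  have hS : ({w | (K.val (pos w)).testBit (v w) = true} : Language Bool) ∈ PSPACE :=
    K.setOf_testBit_val_mem_PSPACE hpos hv
  have hBp : ({w | (K.val (pos w)).testBit (idx w) = true} : Language Bool) ∈ PSPACE :=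
    K.setOf_testBit_val_mem_PSPACE hpos hidx
  have hBn : ({w | (K.val (neg w)).testBit (idx w) = true} : Language Bool) ∈ PSPACE :=
    K.setOf_testBit_val_mem_PSPACE hneg hidx
  have hK1 : ({w | decide (knd w = 1) = true} : Language Bool) ∈ PSPACE :=
    setOf_codeFP_mem_PSPACE (natEq.comp (hknd.pair (const strE (1 : ℕ))))
  have hK0 : ({w | decide (knd w = 0) = true} : Language Bool) ∈ PSPACE :=
    setOf_codeFP_mem_PSPACE (natEq.comp (hknd.pair (const strE (0 : ℕ))))
  have hI : ({w | decide (idx w < v w) = true} : Language Bool) ∈ PSPACE :=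
    setOf_codeFP_mem_PSPACE (natLt.comp (hidx.pair hv))
  -- the Boolean combination
  have hmag : ({w | (¬ (K.val (pos w)).testBit (v w) = true ∧ (K.val (pos w)).testBit (idx w) = true) ∨
      ((K.val (pos w)).testBit (v w) = true ∧ (K.val (neg w)).testBit (idx w) = true)} : Language Bool) ∈ PSPACE :=
    setOf_or_mem_PSPACE_of_complete hB (setOf_and_mem_PSPACE_of_complete hB (compl_mem_PSPACE hS) hBp)
      (setOf_and_mem_PSPACE_of_complete hB hS hBn)
  have hall := setOf_or_mem_PSPACE_of_complete hB (setOf_and_mem_PSPACE_of_complete hB hK1 hS)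
    (setOf_and_mem_PSPACE_of_complete hB hK0 (setOf_and_mem_PSPACE_of_complete hB hI hmag))
  -- it is the language of the statement
  convert hall using 1
  ext w
  simp only [Set.mem_setOf_eq, decide_eq_true_eq]
  have hsign : x w < 0 ↔ (K.val (pos w)).testBit (v w) = true := neg_iff_testBit (hxb w) (hp w)
  have hbit : (x w).natAbs.testBit (idx w) = true ↔
      idx w < v w ∧
        (¬ (K.val (pos w)).testBit (v w) = true ∧ (K.val (pos w)).testBit (idx w) = true ∨
          (K.val (pos w)).testBit (v w) = true ∧ (K.val (neg w)).testBit (idx w) = true) := by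
    by_cases hj : idx w < v w
    · simp only [hj, true_and]
      by_cases hneg0 : x w < 0
      · -- negative: read the bits of the representative of `−x_w`
        have hs := hsign.1 hneg0
        have habs : (x w).natAbs = (-x w).natAbs := (Int.natAbs_neg _).symm
        have h0 : 0 ≤ -x w := by omega
        have hbn : (-x w).natAbs < 2 ^ v w := by rw [← habs]; exact hxb w
        rw [habs, testBit_natAbs_of_nonneg h0 hbn (hn w) (le_of_lt hj)]
        simp [hs]
      · have h0 : 0 ≤ x w := le_of_not_gt hneg0
        have hs : ¬ (K.val (pos w)).testBit (v w) = true := fun h => hneg0 (hsign.2 h)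
        rw [testBit_natAbs_of_nonneg h0 (hxb w) (hp w) (le_of_lt hj)]
        simp [hs]
    · simp only [hj, false_and, iff_false]
      rw [testBit_natAbs_eq_false (hxb w) (by omega)]
      exact Bool.false_ne_true
  rw [hsign, hbit]

end SuccCircuit


end Literature.Computability.Complexity
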